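import Summits.ABC.IUTFork.Cor312GenuineKWildLowerBound
import Summits.ABC.IUTFork.Conditional.AbcOfSGenuineMChosenDepthRadTriple
import HarnessLib

/-!
# [IUTchIII] Cor. 3.12, branch C / R-W, M LINE — the LOWER local type at the members of the M-line fibres of a rational-point
# Θ-volume datum over EVERY pole prime `p ∉ {2, l}` (wild `p ∈ {3, 5}` included): `e = e(w|p)·l`, `l ∣ e`, `15·l ∣ e·t`

PROOF-ONLY file (0 definitions, 0 `Prop` facts) of the abc-iut cell (D-0079 R-W numerics crew seat abc-iut-W-num-6, gen 2; input of the open row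
«W:M-SHALLOW-REYSSAT»). TAKES NO SIDE on [IUTchIII] Cor. 3.12 or on any author. It is the M-LINE PORT of abc-iut-W-neg-1's
`Cor312GenuineKWildLowerBound` (p467688): the SAME place-level theorems of the genuine tower (`ThetaVolumeDatumAt.ramificationIdx_int_eq_mul_prime`,
`ThetaVolumeDatumAt.fifteen_dvd_ramificationIdx_mul`) read at the M-line place `placeOfM T.D u x₀` under a member `x₀ ∈ V̲_u` of the summand-route
M-level setting (`absRamificationIdx_rescaledCompletion`), exactly as this seat's `AbcOfSGenuineMChosenDepthRadTriple` §1 ports the UPPER local types: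
* `GenuineM.absRamificationIdx_kOfM_eq_mul_prime_ratPoint` — `e(K_{v̲(x₀)}/ℚ_p) = e(w | p)·l`, `w = placeOfM x₀ ∩ F`, at a pole prime `p = p_u ∉ {2, l}` of `j(q)`;
* `GenuineM.prime_dvd_absRamificationIdx_kOfM_ratPoint` — `l ∣ e`;
* `GenuineM.fifteen_mul_prime_dvd_absRamificationIdx_kOfM_mul_ratPoint` — `ord_p j(q) = −2t` ⇒ `15·l ∣ e·t`; `…_of_coprime` — `gcd(15,t) = 1 ⇒ 15·l ∣ e`;
* `GenuineM.three_mul_prime_dvd_absRamificationIdx_kOfM_ratPoint` — `ord_p j(q) = −2t`, `3 ∤ t` ⇒ `3·l ∣ e` (the form the M-shallowness of Reyssat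
  `2 + 3¹⁰·109 = 23⁵` at `l = 13` needs at `p = 23`, `t = 5`: `e(K_{v̲}/ℚ_23) ≥ 39`, excluding the non-genuine `e = 13` at which the top label would be M-deep).
HONEST FRAMING: bookkeeping over OUR typed objects; nothing here bears on the printed inequality of [IUTchIII] Cor. 3.12 or on the number-level
`Cor22.Cor312AtDatum`; typed ≠ proved; instantiated ≠ endorsed; no abc claim. [cite: Mochizuki2012, IUTchI Ex. 3.2 (iv) p. 71; IUTchIV Thm. 1.10 p. 22,
Cor. 2.2 (ii) proof (P5) p. 46] [cite: SilvermanATAEC1994, V.5 Thm. 5.3 and Cor. 5.4] [claim: Mochizuki2012, status: disputed] for every IUT quotation.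
-/

noncomputable section

open NumberField IsDedekindDomain

namespace Summit.ABC.IUTFork.Conditional

open Thm311 Thm311.Real Cor312 Cor312Prov Literature.IUT.LogVolume Literature.IUT.HodgeTheaters
  Literature.IUT.LogThetaLattice Literature.NumberTheory.NumberFields Literature.NumberTheory.DiophantineGeometry.GenEll
  Literature.NumberTheory.DiophantineGeometry Literature.IUT.LogVolume.ThetaData Literature.IUT.LogVolume.Cor22

/-- **M line: `e(K_{v̲(x₀)}/ℚ_p) = e(w | p) · l` at every member over a rational pole of `j`, `p = p_u ∉ {2, l}`** (`w = placeOfM x₀ ∩ F`; the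
`l`-division layer contributes EXACTLY `l`, abc-iut-W-neg-1's `ThetaVolumeDatumAt.ramificationIdx_int_eq_mul_prime`), also at the wild primes `p ∈ {3, 5}`.
M twin of `GenuineK.absRamificationIdx_kOf_eq_mul_prime_ratPoint`. [cite: Mochizuki2012, IUTchI Ex. 3.2 (iv) p. 71] [claim: Mochizuki2012, status: disputed] -/
theorem GenuineM.absRamificationIdx_kOfM_eq_mul_prime_ratPoint {q : ℚ} {l : ℕ} (T : Cor22.ThetaVolumeDatumAt (ratPoint q) l)
    (u : FinitePlace ℚ) (hp2 : ratChar u ≠ 2) (hpl : ratChar u ≠ l)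
    (hpole : ∀ v : HeightOneSpectrum (𝓞 ℚ), Rat.HeightOneSpectrum.natGenerator v = ratChar u →
      Literature.IUT.LogVolume.ord ℚ v (Cor22.jInv q) < 0) :
    letI := T.instFieldF; letI := T.instNumberFieldF; letI := T.instAlgebraF; letI := T.instFieldK
    letI := T.instNumberFieldK; letI := T.instAlgebraK; letI := T.instFieldFbar; letI := T.instAlgebraFbar
    letI := T.instAlgebraKFbar; letI := T.instIsElliptic
    ∀ x₀ : (thetaIndexOfInitial T.D).Fibre (Val.non u),
      absRamificationIdx (ratChar u) (kOfM T.D (ratChar u) u (natCast_ratChar_mem u) x₀) =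
        (finBelow T.F T.K (placeOfM T.D u x₀)).asIdeal.ramificationIdx ℤ * l := by
  letI := T.instFieldF; letI := T.instNumberFieldF; letI := T.instAlgebraF; letI := T.instFieldK
  letI := T.instNumberFieldK; letI := T.instAlgebraK; letI := T.instFieldFbar; letI := T.instAlgebraFbar
  letI := T.instAlgebraKFbar; letI := T.instIsElliptic
  haveI hpfact : Fact (ratChar u).Prime := inferInstance
  intro x₀
  set w := placeOfM T.D u x₀ with hwdef
  have hpw : ((ratChar u : ℕ) : 𝓞 T.K) ∈ w.asIdeal := natCast_mem_placeOfM T.D (ratChar u) u (natCast_ratChar_mem u) x₀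
  have hwchar : residueChar T.K w = ratChar u := residueChar_eq_of_natCast_mem (ratChar u) hpw
  have heK : absRamificationIdx (ratChar u) (kOfM T.D (ratChar u) u (natCast_ratChar_mem u) x₀) = w.asIdeal.ramificationIdx ℤ :=
    absRamificationIdx_rescaledCompletion T.K (ratChar u) w hpw
  have hw : residueChar T.K w ∉ ({2, l} : Finset ℕ) := by
    rw [hwchar]
    simp only [Finset.mem_insert, Finset.mem_singleton, not_or]
    exact ⟨hp2, hpl⟩
  -- the place of `ℚ` under `w` is the pole `p`
  have hbad : finBelow (ratPoint q).F T.F (finBelow T.F T.K w) ∈ Cor22.badPlaces (ratPoint q) := by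
    set v : HeightOneSpectrum (𝓞 ℚ) := finBelow (ratPoint q).F T.F (finBelow T.F T.K w) with hvdef
    have hvp : Rat.HeightOneSpectrum.natGenerator v = ratChar u := by
      have hchar : residueChar ℚ v = ratChar u := by
        rw [hvdef]
        change residueChar (ratPoint q).F (finBelow (ratPoint q).F T.F (finBelow T.F T.K w)) = ratChar u
        rw [residueChar_finBelow, residueChar_finBelow, hwchar]
      have hmem : ((ratChar u : ℕ) : 𝓞 ℚ) ∈ v.asIdeal := by
        rw [Cor22.natCast_mem_asIdeal_iff_residueChar_eq v hpfact.out]; exact hchar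
      have hdvd := (UniformABCConjecture.natCast_mem_asIdeal_iff v (ratChar u)).1 hmem
      exact (Nat.prime_dvd_prime_iff_eq (Rat.HeightOneSpectrum.prime_natGenerator v) hpfact.out).1 hdvd
    exact (Cor22.mem_badPlaces_iff_ord_neg (ratPoint q) v).2 (hpole v hvp)
  rw [heK]
  exact T.ramificationIdx_int_eq_mul_prime w hw hbad

/-- **M line: `l ∣ e(K_{v̲(x₀)}/ℚ_p)`** at every member over a rational pole of `j`, `p = p_u ∉ {2, l}` (also `p ∈ {3, 5}`). M twin of
`GenuineK.prime_dvd_absRamificationIdx_kOf_ratPoint`. [cite: Mochizuki2012, IUTchI Ex. 3.2 (iv) p. 71] [claim: Mochizuki2012, status: disputed] -/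
theorem GenuineM.prime_dvd_absRamificationIdx_kOfM_ratPoint {q : ℚ} {l : ℕ} (T : Cor22.ThetaVolumeDatumAt (ratPoint q) l)
    (u : FinitePlace ℚ) (hp2 : ratChar u ≠ 2) (hpl : ratChar u ≠ l)
    (hpole : ∀ v : HeightOneSpectrum (𝓞 ℚ), Rat.HeightOneSpectrum.natGenerator v = ratChar u →
      Literature.IUT.LogVolume.ord ℚ v (Cor22.jInv q) < 0) :
    letI := T.instFieldF; letI := T.instNumberFieldF; letI := T.instAlgebraF; letI := T.instFieldK
    letI := T.instNumberFieldK; letI := T.instAlgebraK; letI := T.instFieldFbar; letI := T.instAlgebraFbar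
    letI := T.instAlgebraKFbar; letI := T.instIsElliptic
    ∀ x₀ : (thetaIndexOfInitial T.D).Fibre (Val.non u),
      l ∣ absRamificationIdx (ratChar u) (kOfM T.D (ratChar u) u (natCast_ratChar_mem u) x₀) := fun x₀ =>
  ⟨_, (GenuineM.absRamificationIdx_kOfM_eq_mul_prime_ratPoint T u hp2 hpl hpole x₀).trans (mul_comm _ _)⟩

/-- **M line: `15·l ∣ e(K_{v̲(x₀)}/ℚ_p)·t`** at every member over a rational pole of `j` of order `2t` (`ord_p j(q) = −2t`, `t ≥ 1`, `p = p_u ∉ {2, l}`,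
including `p ∈ {3, 5}`): the `30`-th root of the Tate parameter in `F_w` (abc-iut-W-neg-1's `ThetaVolumeDatumAt.fifteen_dvd_ramificationIdx_mul`) times the
exact factor `l`. M twin of `GenuineK.fifteen_mul_prime_dvd_absRamificationIdx_kOf_mul_ratPoint`. [cite: SilvermanATAEC1994, V.5 Thm. 5.3 and Cor. 5.4]
[cite: Mochizuki2012, IUTchIV Thm. 1.10 p. 22] [claim: Mochizuki2012, status: disputed] -/
theorem GenuineM.fifteen_mul_prime_dvd_absRamificationIdx_kOfM_mul_ratPoint {q : ℚ} {l : ℕ}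
    (T : Cor22.ThetaVolumeDatumAt (ratPoint q) l) (u : FinitePlace ℚ) (hp2 : ratChar u ≠ 2) (hpl : ratChar u ≠ l) {t : ℕ} (ht : 0 < t)
    (hpole : ∀ v : HeightOneSpectrum (𝓞 ℚ), Rat.HeightOneSpectrum.natGenerator v = ratChar u →
      Literature.IUT.LogVolume.ord ℚ v (Cor22.jInv q) = -(2 * (t : ℤ))) :
    letI := T.instFieldF; letI := T.instNumberFieldF; letI := T.instAlgebraF; letI := T.instFieldK
    letI := T.instNumberFieldK; letI := T.instAlgebraK; letI := T.instFieldFbar; letI := T.instAlgebraFbar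
    letI := T.instAlgebraKFbar; letI := T.instIsElliptic
    ∀ x₀ : (thetaIndexOfInitial T.D).Fibre (Val.non u),
      15 * l ∣ absRamificationIdx (ratChar u) (kOfM T.D (ratChar u) u (natCast_ratChar_mem u) x₀) * t := by
  letI := T.instFieldF; letI := T.instNumberFieldF; letI := T.instAlgebraF; letI := T.instFieldK
  letI := T.instNumberFieldK; letI := T.instAlgebraK; letI := T.instFieldFbar; letI := T.instAlgebraFbar
  letI := T.instAlgebraKFbar; letI := T.instIsElliptic
  haveI hpfact : Fact (ratChar u).Prime := inferInstance
  have hpole' : ∀ v : HeightOneSpectrum (𝓞 ℚ), Rat.HeightOneSpectrum.natGenerator v = ratChar u →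
      Literature.IUT.LogVolume.ord ℚ v (Cor22.jInv q) < 0 := fun v hv => by
    rw [hpole v hv]
    have : (0 : ℤ) < t := by exact_mod_cast ht
    linarith
  intro x₀
  rw [GenuineM.absRamificationIdx_kOfM_eq_mul_prime_ratPoint T u hp2 hpl hpole' x₀]
  set w' := placeOfM T.D u x₀ with hw'def
  set w := finBelow T.F T.K w' with hwdef
  have hpw : ((ratChar u : ℕ) : 𝓞 T.K) ∈ w'.asIdeal := natCast_mem_placeOfM T.D (ratChar u) u (natCast_ratChar_mem u) x₀
  have hwchar : residueChar T.K w' = ratChar u := residueChar_eq_of_natCast_mem (ratChar u) hpw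
  -- the place of `ℚ` under `w` is the pole `p`
  set v : HeightOneSpectrum (𝓞 ℚ) := finBelow (ratPoint q).F T.F w with hvdef
  have hvp : Rat.HeightOneSpectrum.natGenerator v = ratChar u := by
    have hchar : residueChar ℚ v = ratChar u := by
      rw [hvdef]
      change residueChar (ratPoint q).F (finBelow (ratPoint q).F T.F (finBelow T.F T.K w')) = ratChar u
      rw [residueChar_finBelow, residueChar_finBelow, hwchar]
    have hmem : ((ratChar u : ℕ) : 𝓞 ℚ) ∈ v.asIdeal := by
      rw [Cor22.natCast_mem_asIdeal_iff_residueChar_eq v hpfact.out]; exact hchar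
    have hdvd := (UniformABCConjecture.natCast_mem_asIdeal_iff v (ratChar u)).1 hmem
    exact (Nat.prime_dvd_prime_iff_eq (Rat.HeightOneSpectrum.prime_natGenerator v) hpfact.out).1 hdvd
  -- `e(w | p) = e(w | v)` over `ℚ`
  have hew : w.asIdeal.ramificationIdx ℤ = w.asIdeal.ramificationIdx (𝓞 (ratPoint q).F) := by
    haveI : (finBelow (ratPoint q).F T.F w).asIdeal.IsMaximal := (finBelow (ratPoint q).F T.F w).isMaximal
    have h1 : ramIdx (ratPoint q).F (w.under (𝓞 (ratPoint q).F)) = 1 := by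
      rw [ramIdx_eq]
      exact Literature.NumberTheory.EllipticCurves.Fisher2016.ramificationIdx_int_rat_eq_one _
    rw [ThetaData.absRamificationIdx_eq_ramIdx_mul (F := (ratPoint q).F) w]
    erw [h1, one_mul]
    exact Ideal.ramificationIdx'_eq_ramificationIdx (finBelow (ratPoint q).F T.F w).asIdeal w.asIdeal
      (finBelow (ratPoint q).F T.F w).ne_bot
  have h15 : 15 ∣ w.asIdeal.ramificationIdx (𝓞 (ratPoint q).F) * t :=
    T.fifteen_dvd_ramificationIdx_mul w (by rw [← hvdef]; exact hpole v hvp) ht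
  rw [hew, mul_assoc, mul_comm l t, ← mul_assoc]
  exact mul_dvd_mul h15 dvd_rfl

/-- **M line: `15·l ∣ e(K_{v̲(x₀)}/ℚ_p)` when `gcd(15, t) = 1`.** M twin of `GenuineK.fifteen_mul_prime_dvd_absRamificationIdx_kOf_ratPoint_of_coprime`.
[cite: SilvermanATAEC1994, V.5 Thm. 5.3 and Cor. 5.4] [claim: Mochizuki2012, status: disputed] -/
theorem GenuineM.fifteen_mul_prime_dvd_absRamificationIdx_kOfM_ratPoint_of_coprime {q : ℚ} {l : ℕ}
    (T : Cor22.ThetaVolumeDatumAt (ratPoint q) l) (u : FinitePlace ℚ) (hp2 : ratChar u ≠ 2) (hpl : ratChar u ≠ l) {t : ℕ} (ht : 0 < t)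
    (hcop : Nat.Coprime 15 t)
    (hpole : ∀ v : HeightOneSpectrum (𝓞 ℚ), Rat.HeightOneSpectrum.natGenerator v = ratChar u →
      Literature.IUT.LogVolume.ord ℚ v (Cor22.jInv q) = -(2 * (t : ℤ))) :
    letI := T.instFieldF; letI := T.instNumberFieldF; letI := T.instAlgebraF; letI := T.instFieldK
    letI := T.instNumberFieldK; letI := T.instAlgebraK; letI := T.instFieldFbar; letI := T.instAlgebraFbar
    letI := T.instAlgebraKFbar; letI := T.instIsElliptic
    ∀ x₀ : (thetaIndexOfInitial T.D).Fibre (Val.non u),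
      15 * l ∣ absRamificationIdx (ratChar u) (kOfM T.D (ratChar u) u (natCast_ratChar_mem u) x₀) := by
  letI := T.instFieldF; letI := T.instNumberFieldF; letI := T.instAlgebraF; letI := T.instFieldK
  letI := T.instNumberFieldK; letI := T.instAlgebraK; letI := T.instFieldFbar; letI := T.instAlgebraFbar
  letI := T.instAlgebraKFbar; letI := T.instIsElliptic
  intro x₀
  have h := GenuineM.fifteen_mul_prime_dvd_absRamificationIdx_kOfM_mul_ratPoint T u hp2 hpl ht hpole x₀
  have hl : l ∣ absRamificationIdx (ratChar u) (kOfM T.D (ratChar u) u (natCast_ratChar_mem u) x₀) :=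
    GenuineM.prime_dvd_absRamificationIdx_kOfM_ratPoint T u hp2 hpl (fun v hv => by
      rw [hpole v hv]; have : (0 : ℤ) < t := by exact_mod_cast ht
      linarith) x₀
  obtain ⟨e₁, he₁⟩ := hl
  rw [he₁] at h ⊢
  have hl0 : 0 < l := T.D.l_prime.pos
  have h' : l * 15 ∣ l * (e₁ * t) := by rw [mul_comm l 15, ← mul_assoc]; exact h
  have h15 : 15 ∣ e₁ * t := Nat.dvd_of_mul_dvd_mul_left hl0 h'
  have h15' : 15 ∣ e₁ := hcop.dvd_of_dvd_mul_right h15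
  rw [mul_comm 15 l]
  exact mul_dvd_mul_left l h15'

/-- **M line: `3·l ∣ e(K_{v̲(x₀)}/ℚ_p)` when `3 ∤ t`** (`ord_p j(q) = −2t`): from `15·l ∣ e·t` and `gcd(3, t) = 1`. At Reyssat `2 + 3¹⁰·109 = 23⁵`, `p = 23`,
`t = 5`: `3·l ∣ e`, so `e ≥ 39` at `l = 13` — the lower bound the M-shallowness of the top label needs there. [cite: SilvermanATAEC1994, V.5 Thm. 5.3 and Cor. 5.4]
[claim: Mochizuki2012, status: disputed] -/
theorem GenuineM.three_mul_prime_dvd_absRamificationIdx_kOfM_ratPoint {q : ℚ} {l : ℕ}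
    (T : Cor22.ThetaVolumeDatumAt (ratPoint q) l) (u : FinitePlace ℚ) (hp2 : ratChar u ≠ 2) (hpl : ratChar u ≠ l) {t : ℕ} (ht : 0 < t)
    (h3 : Nat.Coprime 3 t)
    (hpole : ∀ v : HeightOneSpectrum (𝓞 ℚ), Rat.HeightOneSpectrum.natGenerator v = ratChar u →
      Literature.IUT.LogVolume.ord ℚ v (Cor22.jInv q) = -(2 * (t : ℤ))) :
    letI := T.instFieldF; letI := T.instNumberFieldF; letI := T.instAlgebraF; letI := T.instFieldK
    letI := T.instNumberFieldK; letI := T.instAlgebraK; letI := T.instFieldFbar; letI := T.instAlgebraFbar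
    letI := T.instAlgebraKFbar; letI := T.instIsElliptic
    ∀ x₀ : (thetaIndexOfInitial T.D).Fibre (Val.non u),
      3 * l ∣ absRamificationIdx (ratChar u) (kOfM T.D (ratChar u) u (natCast_ratChar_mem u) x₀) := by
  letI := T.instFieldF; letI := T.instNumberFieldF; letI := T.instAlgebraF; letI := T.instFieldK
  letI := T.instNumberFieldK; letI := T.instAlgebraK; letI := T.instFieldFbar; letI := T.instAlgebraFbar
  letI := T.instAlgebraKFbar; letI := T.instIsElliptic
  intro x₀
  have h := GenuineM.fifteen_mul_prime_dvd_absRamificationIdx_kOfM_mul_ratPoint T u hp2 hpl ht hpole x₀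
  have hl : l ∣ absRamificationIdx (ratChar u) (kOfM T.D (ratChar u) u (natCast_ratChar_mem u) x₀) :=
    GenuineM.prime_dvd_absRamificationIdx_kOfM_ratPoint T u hp2 hpl (fun v hv => by
      rw [hpole v hv]; have : (0 : ℤ) < t := by exact_mod_cast ht
      linarith) x₀
  obtain ⟨e₁, he₁⟩ := hl
  rw [he₁] at h ⊢
  have hl0 : 0 < l := T.D.l_prime.pos
  have h' : l * 15 ∣ l * (e₁ * t) := by rw [mul_comm l 15, ← mul_assoc]; exact h
  have h15 : 15 ∣ e₁ * t := Nat.dvd_of_mul_dvd_mul_left hl0 h'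
  have h3' : 3 ∣ e₁ * t := (show (3 : ℕ) ∣ 15 by norm_num).trans h15
  have h3'' : 3 ∣ e₁ := h3.dvd_of_dvd_mul_right h3'
  rw [mul_comm 3 l]
  exact mul_dvd_mul_left l h3''

end Summit.ABC.IUTFork.Conditional

end
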